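import Literature.MathematicalPhysics.QuantumManyBody.BoseEinsteinCondensation
import HarnessLib

/-!
# Crux `TorusHalfSwapOverlap` (stmt-AtomisticToContinuum-14393), line `birth`: stub `stub_hardCorePacking` (S7a)

Route `BECSwapNoCatastrophe` (sub-problem `BoseEinsteinCondensation`), lead c6 (2026-08-17). VOLUME PACKING IN `ℝ³`:
a finite `a`-separated set `s ⊂ ℝ³` (`a > 0`) all of whose points lie within distance `R ≥ 0` of a point `p` has at
most `(1 + 2R/a)³` elements. Proof: the open balls `B(x, a/2)`, `x ∈ s`, are pairwise disjoint (two distinct centres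
are `≥ a = a/2 + a/2` apart, `Metric.ball_disjoint_ball`) and all lie in `B(p, R + a/2)` (triangle inequality), so
`∑_{x ∈ s} vol B(x, a/2) = vol (⋃_{x ∈ s} B(x, a/2)) ≤ vol B(p, R + a/2)` (`measure_biUnion_finset`, `measure_mono`).
By the scaling of Lebesgue measure (`Measure.addHaar_ball_of_pos`, `finrank ℝ ℝ³ = 3`) `vol B(x, r) = r³ · vol B(0, 1)`
with `0 < vol B(0, 1) < ∞`, this reads `card s · (a/2)³ ≤ (R + a/2)³`, i.e.
`card s ≤ ((R + a/2)/(a/2))³ = (1 + 2R/a)³`. [folklore]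
-/

noncomputable section

open MeasureTheory
open scoped ENNReal NNReal

namespace Summit.AtomisticToContinuum.BoseEinsteinCondensation.Cruxes.TorusHalfSwapOverlap.Birth

open Literature.MathematicalPhysics.QuantumManyBody.BoseGas

/-! ### Helper lemmas (inside `namespace HardCorePacking … end HardCorePacking`) -/

namespace HardCorePacking

/-- The open balls of radius `a/2` around the points of an `a`-separated finite set are pairwise disjoint.
[folklore] -/
theorem pairwiseDisjoint_ball {a : ℝ} {s : Finset Space}
    (hsep : ∀ x ∈ s, ∀ y ∈ s, x ≠ y → a ≤ ‖x - y‖) :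
    Set.PairwiseDisjoint (↑s : Set Space) (fun x => Metric.ball x (a / 2)) := by
  intro x hx y hy hxy
  refine Metric.ball_disjoint_ball ?_
  rw [dist_eq_norm]
  linarith [hsep x hx y hy hxy]

/-- If every point of `s` is within distance `R` of `p`, the balls `B(x, a/2)`, `x ∈ s`, lie in `B(p, R + a/2)`.
[folklore] -/
theorem biUnion_ball_subset {a R : ℝ} {s : Finset Space} {p : Space}
    (hball : ∀ x ∈ s, ‖x - p‖ ≤ R) :
    (⋃ x ∈ s, Metric.ball x (a / 2)) ⊆ Metric.ball p (R + a / 2) := by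
  intro z hz
  simp only [Set.mem_iUnion] at hz
  obtain ⟨x, hx, hzx⟩ := hz
  rw [Metric.mem_ball] at hzx ⊢
  have hxp : dist x p ≤ R := by
    rw [dist_eq_norm]
    exact hball x hx
  calc dist z p ≤ dist z x + dist x p := dist_triangle _ _ _
    _ < a / 2 + R := by linarith
    _ = R + a / 2 := by ring

/-- Scaling of the Lebesgue volume of balls in `ℝ³`: `vol B(x, r) = r³ · vol B(0, 1)` for `r > 0`. [folklore] -/
theorem volume_ball_eq (x : Space) {r : ℝ} (hr : 0 < r) :
    volume (Metric.ball x r) = ENNReal.ofReal (r ^ 3) * volume (Metric.ball (0 : Space) 1) := by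
  rw [Measure.addHaar_ball_of_pos volume x hr, finrank_euclideanSpace_fin]

/-- The volume comparison behind the packing bound: `card s · (a/2)³ ≤ (R + a/2)³`. [folklore] -/
theorem card_mul_le {a R : ℝ} (ha : 0 < a) (hR : 0 ≤ R) {s : Finset Space} {p : Space}
    (hsep : ∀ x ∈ s, ∀ y ∈ s, x ≠ y → a ≤ ‖x - y‖) (hball : ∀ x ∈ s, ‖x - p‖ ≤ R) :
    (s.card : ℝ) * (a / 2) ^ 3 ≤ (R + a / 2) ^ 3 := by
  have ha2 : 0 < a / 2 := by positivity
  have hRa : 0 < R + a / 2 := by positivity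
  have hc0 : volume (Metric.ball (0 : Space) 1) ≠ 0 :=
    (Metric.measure_ball_pos volume (0 : Space) one_pos).ne'
  have hctop : volume (Metric.ball (0 : Space) 1) ≠ ⊤ := measure_ball_lt_top.ne
  -- additivity over the disjoint balls
  have hunion : volume (⋃ x ∈ s, Metric.ball x (a / 2)) = ∑ x ∈ s, volume (Metric.ball x (a / 2)) :=
    measure_biUnion_finset (pairwiseDisjoint_ball hsep) (fun _ _ => measurableSet_ball)
  have hsum : ∑ x ∈ s, volume (Metric.ball x (a / 2))
      = (s.card : ℝ≥0∞) * (ENNReal.ofReal ((a / 2) ^ 3) * volume (Metric.ball (0 : Space) 1)) := by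
    simp_rw [volume_ball_eq _ ha2]
    rw [Finset.sum_const, nsmul_eq_mul]
  -- monotonicity: the union lies in the big ball
  have hmono : (s.card : ℝ≥0∞) * (ENNReal.ofReal ((a / 2) ^ 3) * volume (Metric.ball (0 : Space) 1))
      ≤ ENNReal.ofReal ((R + a / 2) ^ 3) * volume (Metric.ball (0 : Space) 1) := by
    rw [← hsum, ← hunion, ← volume_ball_eq p hRa]
    exact measure_mono (biUnion_ball_subset hball)
  -- cancel the (positive, finite) unit-ball volume and return to `ℝ`
  have h2 : (s.card : ℝ≥0∞) * ENNReal.ofReal ((a / 2) ^ 3) ≤ ENNReal.ofReal ((R + a / 2) ^ 3) := by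
    rw [← mul_assoc] at hmono
    exact (ENNReal.mul_le_mul_iff_left hc0 hctop).1 hmono
  have h3 : ENNReal.ofReal ((s.card : ℝ) * (a / 2) ^ 3) ≤ ENNReal.ofReal ((R + a / 2) ^ 3) := by
    rwa [ENNReal.ofReal_mul (Nat.cast_nonneg _), ENNReal.ofReal_natCast]
  exact (ENNReal.ofReal_le_ofReal_iff (pow_nonneg hRa.le 3)).1 h3

end HardCorePacking

open HardCorePacking

/-! ### The registered stub -/

/-- S7a — `stub_hardCorePacking` (M; worker): volume packing in `ℝ³` — a finite `a`-separated set of points inside a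
ball of radius `R` has at most `(1 + 2R/a)³` elements (the balls `B(x, a/2)` are disjoint and lie in `B(p, R + a/2)`;
compare Lebesgue volumes). [folklore] -/
theorem stub_hardCorePacking :
    ∀ (a R : ℝ), 0 < a → 0 ≤ R → ∀ (s : Finset Space) (p : Space),
      (∀ x ∈ s, ∀ y ∈ s, x ≠ y → a ≤ ‖x - y‖) → (∀ x ∈ s, ‖x - p‖ ≤ R) →
      (s.card : ℝ) ≤ (1 + 2 * R / a) ^ 3 := by
  intro a R ha hR s p hsep hball
  have h := card_mul_le ha hR hsep hball
  have ha2 : 0 < (a / 2) ^ 3 := by positivity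
  have key : (1 + 2 * R / a) ^ 3 = (R + a / 2) ^ 3 / (a / 2) ^ 3 := by
    rw [← div_pow]
    congr 1
    field_simp
    ring
  rw [key, le_div_iff₀ ha2]
  exact h

end Summit.AtomisticToContinuum.BoseEinsteinCondensation.Cruxes.TorusHalfSwapOverlap.Birth
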